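import Literature.NumberTheory.EllipticCurves.Curve6137TwoIsogenyDescent
import Literature.NumberTheory.EllipticCurves.IsogenyTwoTorsionProofs
import Literature.NumberTheory.EllipticCurves.IsogenyVariableChangeProofs
import Literature.NumberTheory.EllipticCurves.SelmerCorankIsogenyProofs
import Literature.NumberTheory.EllipticCurves.IwasawaLeadingTermProofs
import Literature.NumberTheory.EllipticCurves.BSDInvariantsProofs
import Literature.NumberTheory.EllipticCurves.ShaPTorsionQuadraticSplitting
import HarnessLib

/-!
# The `2`-isogeny descent on Cremona's `1088j1` (rank `2`): `S^{(φ̂)} ⊆ {±1, ±2}`, `S^{(φ)} ⊆ {1, 2, 17, 34}`,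
# hence `rank ≤ 2`, and — given `rank ≥ 2` — `Ш(E/ℚ)[2] = 0`, `t_2(E) = 0`

Topic `Literature/NumberTheory/EllipticCurves`, family `bsd`. Theorems only. The curve is Cremona's `1088j1`,
`E₁₀₈₈ = [0, 1, 0, −25, 39] : y² = x³ + x² − 25x + 39` (`N = 1088 = 2⁶·17`, rank `2`, listed generators `(1, 4)`,
`(5, 8)`; a row of the tree's rank-2 `p`-adic atlas `Rank2ObservatoryPadicAtlasR2A11`, cells at `p = 5, 7, 11, 13`).
Its rational `2`-torsion point is `(3, 0)`; moving it to the origin (`x ↦ x + 3`, `smul_E_eq_X`) gives the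
two-torsion normal form

  `X = [0, 10, 0, 8, 0] : y² = x³ + 10x² + 8x`,  `X' = X.twoIsogenyCodomain = [0, −20, 0, 68, 0]`.

The descent (Silverman, *AEC*, Prop. X.4.9, Example X.4.10), in the tree's currency `twoIsogenySelmerGroup a b`
(squarefree `d ∣ b` with `w² = d u⁴ + a u²z² + (b/d) z⁴` everywhere locally soluble):
* `S(10, 8) ⊆ {1, −1, 2, −2}` (all squarefree divisors of `8`; nothing to exclude), so `dim₂ S^{(φ̂)} ≤ 2`;
* `S(−20, 68) ⊆ {1, 2, 17, 34}`: the negative squarefree divisors of `68` die over `ℝ` (`68/d < 0`, `a = −20 ≤ 0`;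
  `not_isSoluble_real_twoIsogenyQuartic_of_neg`), so `dim₂ S^{(φ)} ≤ 2`. No `p`-adic certificate is needed.
Consequences: `rank X(ℚ) ≤ 2` (`rank + 2 ≤ dim S + dim S'`, tree `twoIsogeny_mordellWeilRank_add_two_le_holds`);
and GIVEN `2 ≤ rank X(ℚ)` (two independent points — supplied Summits-side by the observatory's kernel
certificate `Rank2Observatory.C1088j1.two_le_rank`, which this Literature file may not import) the descent is
SHARP: `rank = 2`, `Ш(X/ℚ)[2] = 0` (`forall_mem_sha_two_smul_eq_zero_of_selmerRank_add_le`), `t_2(X) = 0`, and the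
same for the model `E₁₀₈₈` (`t_p` is an isogeny invariant; `#Ш[n]` is invariant under changes of variables).

This is the descent half of the first CROSS-PRIME ROW of route ShaPrimaryTransfer joining a kernel `2`-descent
door with the rank-2 `p`-adic atlas (Stein–Wuthrich) at `p ∈ {5, 7, 11, 13}` on one curve (Summits-side join).

## References

* J. H. Silverman, *The Arithmetic of Elliptic Curves*, 2nd ed. (2009), Prop. X.4.9, Example X.4.10, Thm. X.4.2,
  III.3.1(b). [SilvermanAEC2009]
* J. E. Cremona, *Algorithms for Modular Elliptic Curves*, 2nd ed. (1997), Table 1 (curve `1088j1`).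
  [Cremona1997Algorithms]
-/

noncomputable section

open scoped Classical
open scoped AddSubgroup

namespace Literature.NumberTheory.EllipticCurves

namespace Curve1088j1

open _root_.WeierstrassCurve _root_.WeierstrassCurve.Affine

/-! ## 0. The curves -/

/-- `b(a² − 4b) = 8 · 68 ≠ 0` for `X = E_{10,8}`. [cite: SilvermanAEC2009, Prop. X.4.9] -/
theorem habX : (8 : ℤ) * ((10 : ℤ) ^ 2 - 4 * 8) ≠ 0 := by norm_num

/-- The tree's literal `E_{10,8}` is `X`. [cite: SilvermanAEC2009, Prop. X.4.9] -/
theorem lit_X : (⟨0, ((10 : ℤ) : ℚ), 0, ((8 : ℤ) : ℚ), 0⟩ : WeierstrassCurve ℚ) = ⟨0, 10, 0, 8, 0⟩ := by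
  ext <;> push_cast <;> ring

/-- The tree's literal `E_{−2a, a²−4b}` for `(a,b) = (10, 8)` is `X' = [0, −20, 0, 68, 0]`. [cite: SilvermanAEC2009, Prop. X.4.9] -/
theorem lit_X' :
    (⟨0, ((-2 * 10 : ℤ) : ℚ), 0, (((10 : ℤ) ^ 2 - 4 * 8 : ℤ) : ℚ), 0⟩ : WeierstrassCurve ℚ) = ⟨0, -20, 0, 68, 0⟩ := by
  ext <;> push_cast <;> ring

/-- The half-model literal for `(a,b) = (10, 8)`. [cite: SilvermanAEC2009, Prop. X.4.9] -/
private theorem lit_V₀ :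
    (⟨0, -((10 : ℤ) : ℚ) / 2, 0, (((10 : ℤ) : ℚ) ^ 2 - 4 * (8 : ℤ)) / 16, 0⟩ : WeierstrassCurve ℚ) =
      ⟨0, -5, 0, 17 / 4, 0⟩ := by
  ext <;> push_cast <;> ring

/-- `X = [0, 10, 0, 8, 0]` is an elliptic curve (`Δ = 16·8²·68`). [cite: SilvermanAEC2009, Prop. X.4.9] -/
theorem isElliptic_X : (⟨0, 10, 0, 8, 0⟩ : WeierstrassCurve ℚ).IsElliptic := by
  rw [← lit_X]; exact isElliptic_mk_of_ne_zero (F := ℚ) habX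

/-- `X' = [0, −20, 0, 68, 0]` is an elliptic curve. [cite: SilvermanAEC2009, Prop. X.4.9] -/
theorem isElliptic_X' : (⟨0, -20, 0, 68, 0⟩ : WeierstrassCurve ℚ).IsElliptic := by
  rw [← lit_X']; exact isElliptic_mk_of_ne_zero (F := ℚ) (twoIsogenyCodomain_ne_zero habX)

/-- The half-model of `X'` is an elliptic curve. [cite: SilvermanAEC2009, Prop. X.4.9] -/
private theorem isElliptic_V₀ : (⟨0, -5, 0, 17 / 4, 0⟩ : WeierstrassCurve ℚ).IsElliptic := by
  rw [← lit_V₀]; exact isElliptic_halfModel habX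

/-- `E₁₀₈₈ = [0, 1, 0, −25, 39]` (Cremona `1088j1`) is an elliptic curve: `Δ = 2⁸ · 17²`.
[cite: Cremona1997Algorithms, Table 1 (curve 1088j1)] -/
theorem isElliptic_E : (⟨0, 1, 0, -25, 39⟩ : WeierstrassCurve ℚ).IsElliptic :=
  ⟨by norm_num [WeierstrassCurve.Δ, WeierstrassCurve.b₂, WeierstrassCurve.b₄, WeierstrassCurve.b₆, WeierstrassCurve.b₈]⟩

/-- **`X = ⟨1, 3, 0, 0⟩ • E₁₀₈₈`**: moving the rational `2`-torsion point `(3, 0)` of `1088j1` to the origin gives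
`y² = x³ + 10x² + 8x`. [cite: SilvermanAEC2009, III.3.1(b)] -/
theorem smul_E_eq_X :
    (⟨1, 3, 0, 0⟩ : VariableChange ℚ) • (⟨0, 1, 0, -25, 39⟩ : WeierstrassCurve ℚ) = ⟨0, 10, 0, 8, 0⟩ := by
  ext
  · simp [WeierstrassCurve.variableChange_a₁]
  · rw [WeierstrassCurve.variableChange_a₂]; norm_num
  · simp [WeierstrassCurve.variableChange_a₃]
  · rw [WeierstrassCurve.variableChange_a₄]; norm_num
  · rw [WeierstrassCurve.variableChange_a₆]; norm_num

/-- `E₁₀₈₈ ~ X` over `ℚ` (isomorphic models). [cite: SilvermanAEC2009, III.3.1(b)] -/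
theorem isIsogenous_E_X :
    IsIsogenous (⟨0, 1, 0, -25, 39⟩ : WeierstrassCurve ℚ) (⟨0, 10, 0, 8, 0⟩ : WeierstrassCurve ℚ) :=
  isIsogenous_of_smul_eq smul_E_eq_X

/-! ## 1. The two Selmer sets -/

/-- A squarefree integer dividing `8` is `±1` or `±2`. [cite: SilvermanAEC2009, Prop. X.4.9] -/
private theorem mem_of_dvd_8 {d : ℤ} (hsq : Squarefree d) (hd : d ∣ (8 : ℤ)) :
    d ∈ ({1, -1, 2, -2} : Finset ℤ) := by
  have hrad : d ∣ 2 := by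
    have h3 : d ∣ (2 : ℤ) ^ 3 := by simpa using hd
    exact (hsq.dvd_pow_iff_dvd (by norm_num)).mp h3
  have h1 : d.natAbs ∣ 2 := by
    have := Int.natAbs_dvd_natAbs.mpr hrad
    simpa using this
  have h2 : d.natAbs ∈ Nat.divisors 2 := Nat.mem_divisors.mpr ⟨h1, by norm_num⟩
  rw [show Nat.divisors 2 = {1, 2} by decide] at h2
  simp only [Finset.mem_insert, Finset.mem_singleton] at h2 ⊢
  rcases Int.natAbs_eq d with h | h <;> rw [h] <;> rcases h2 with h2 | h2 <;> simp [h2]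

/-- **`S^{(φ̂)} = S(10, 8) ⊆ {1, −1, 2, −2}`** (all squarefree divisors of `b = 8`). [cite: SilvermanAEC2009, Prop. X.4.9] -/
theorem twoIsogenySelmerGroup_X_subset :
    twoIsogenySelmerGroup (10) (8) ⊆ ({1, -1, 2, -2} : Finset ℤ) := by
  intro d hd
  obtain ⟨hsq, hdvd, -⟩ := (mem_twoIsogenySelmerGroup_iff (a := 10) (by norm_num : (8 : ℤ) ≠ 0)).mp hd
  exact mem_of_dvd_8 hsq hdvd

/-- A squarefree integer dividing `68` is `±` a divisor of `34`. [cite: SilvermanAEC2009, Prop. X.4.9] -/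
private theorem mem_of_dvd_68 {d : ℤ} (hsq : Squarefree d) (hd : d ∣ (68 : ℤ)) :
    d ∈ ({1, -1, 2, -2, 17, -17, 34, -34} : Finset ℤ) := by
  have hrad : d ∣ 34 := by
    have h5 : d ∣ (34 : ℤ) ^ 2 := dvd_trans hd ⟨17, by norm_num⟩
    exact (hsq.dvd_pow_iff_dvd (by norm_num)).mp h5
  have h1 : d.natAbs ∣ 34 := by
    have := Int.natAbs_dvd_natAbs.mpr hrad
    simpa using this
  have h2 : d.natAbs ∈ Nat.divisors 34 := Nat.mem_divisors.mpr ⟨h1, by norm_num⟩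
  rw [show Nat.divisors 34 = {1, 2, 17, 34} by decide] at h2
  simp only [Finset.mem_insert, Finset.mem_singleton] at h2 ⊢
  rcases Int.natAbs_eq d with h | h <;> rw [h] <;>
    rcases h2 with h2 | h2 | h2 | h2 <;> simp [h2]

/-- **`S^{(φ)} = S(−20, 68) ⊆ {1, 2, 17, 34}`**: the negative squarefree divisors of `68` die over `ℝ`
(`d < 0`, `68/d < 0`, `a = −20 ≤ 0`). [cite: SilvermanAEC2009, Prop. X.4.9 and Example X.4.10] -/
theorem twoIsogenySelmerGroup_X'_subset :
    twoIsogenySelmerGroup (-20) (68) ⊆ ({1, 2, 17, 34} : Finset ℤ) := by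
  intro d hd
  obtain ⟨hsq, hdvd, hloc⟩ := (mem_twoIsogenySelmerGroup_iff (a := -20) (by norm_num : (68 : ℤ) ≠ 0)).mp hd
  have hdpos : 0 < d := by
    rcases lt_trichotomy d 0 with hneg | h0 | hpos
    · exfalso
      have hquot : (68 : ℤ) / d < 0 := by
        obtain ⟨k, hk⟩ := hdvd
        rw [hk, Int.mul_ediv_cancel_left _ hneg.ne]
        nlinarith
      exact not_isSoluble_real_twoIsogenyQuartic_of_neg hneg hquot (by norm_num) hloc.1
    · exact absurd h0 hsq.ne_zero
    · exact hpos
  have hmem := mem_of_dvd_68 hsq hdvd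
  simp only [Finset.mem_insert, Finset.mem_singleton] at hmem ⊢
  rcases hmem with rfl | rfl | rfl | rfl | rfl | rfl | rfl | rfl
  · exact Or.inl rfl
  · norm_num at hdpos
  · exact Or.inr (Or.inl rfl)
  · norm_num at hdpos
  · exact Or.inr (Or.inr (Or.inl rfl))
  · norm_num at hdpos
  · exact Or.inr (Or.inr (Or.inr rfl))
  · norm_num at hdpos

/-- `2^k ≤ 2^n` forces `k ≤ n`. [cite: SilvermanAEC2009, Prop. X.4.9] -/
private theorem le_of_two_pow_le {k n : ℕ} (h : 2 ^ k ≤ 2 ^ n) : k ≤ n :=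
  (Nat.pow_le_pow_iff_right (by norm_num)).mp h

/-- **`dim₂ S(10, 8) ≤ 2` and `dim₂ S'(10, 8) = dim₂ S(−20, 68) ≤ 2`.** [cite: SilvermanAEC2009, Prop. X.4.9] -/
theorem twoIsogenySelmerRank_X_add_le :
    twoIsogenySelmerRank (10) (8) ≤ 2 ∧ twoIsogenySelmerRank' (10) (8) ≤ 2 := by
  constructor
  · apply le_of_two_pow_le
    rw [two_pow_twoIsogenySelmerRank_eq_card habX]
    exact (Finset.card_le_card twoIsogenySelmerGroup_X_subset).trans (by decide)
  · apply le_of_two_pow_le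
    rw [two_pow_twoIsogenySelmerRank'_eq_card habX, twoIsogenySelmerGroup'_eq,
      show (-2 * 10 : ℤ) = -20 by norm_num, show ((10 : ℤ) ^ 2 - 4 * 8 : ℤ) = 68 by norm_num]
    exact (Finset.card_le_card twoIsogenySelmerGroup_X'_subset).trans (by decide)

/-! ## 2. Rank `≤ 2`; sharpness given rank `≥ 2` -/

/-- **`rank X(ℚ) ≤ 2`** for `X : y² = x³ + 10x² + 8x`: `rank + 2 ≤ dim₂ S + dim₂ S' ≤ 4`.
[cite: SilvermanAEC2009, Prop. X.4.7 with Thm. X.4.2(a)] -/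
theorem mordellWeilRank_X_le_two : (⟨0, 10, 0, 8, 0⟩ : WeierstrassCurve ℚ).mordellWeilRank ≤ 2 := by
  have h := twoIsogeny_mordellWeilRank_add_two_le_holds 10 8 habX
  rw [lit_X] at h
  have h2 := twoIsogenySelmerRank_X_add_le
  omega

/-- **`rank E₁₀₈₈(ℚ) ≤ 2`** for Cremona's `1088j1` (rank is invariant under the change of variables).
[cite: SilvermanAEC2009, Prop. X.4.7 and III.3.1(b)] -/
theorem mordellWeilRank_E_le_two : (⟨0, 1, 0, -25, 39⟩ : WeierstrassCurve ℚ).mordellWeilRank ≤ 2 := by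
  have h := mordellWeilRank_variableChange_holds (⟨0, 1, 0, -25, 39⟩ : WeierstrassCurve ℚ)
    (⟨1, 3, 0, 0⟩ : VariableChange ℚ)
  rw [mordellWeilRank_variableChange, smul_E_eq_X] at h
  rw [← h]; exact mordellWeilRank_X_le_two

/-- **The descent is sharp once `rank ≥ 2`**: if `2 ≤ rank X(ℚ)` then `Ш(X/ℚ)[2] = 0` (every class of `Ш`
killed by `2` is zero), since then `dim₂ S + dim₂ S' ≤ 4 ≤ rank + 2`. [cite: SilvermanAEC2009, Prop. X.4.7 with Thm. X.4.2(a)] -/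
theorem forall_mem_sha_X_two_smul_eq_zero (h2 : 2 ≤ (⟨0, 10, 0, 8, 0⟩ : WeierstrassCurve ℚ).mordellWeilRank) :
    ∀ c ∈ (⟨0, 10, 0, 8, 0⟩ : WeierstrassCurve ℚ).sha, 2 • c = 0 → c = 0 := by
  haveI : (⟨0, -((10 : ℤ) : ℚ) / 2, 0, (((10 : ℤ) : ℚ) ^ 2 - 4 * (8 : ℤ)) / 16, 0⟩ :
      WeierstrassCurve ℚ).IsElliptic := by rw [lit_V₀]; exact isElliptic_V₀
  haveI : (⟨0, ((10 : ℤ) : ℚ), 0, ((8 : ℤ) : ℚ), 0⟩ : WeierstrassCurve ℚ).IsElliptic := by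
    rw [lit_X]; exact isElliptic_X
  have hle : twoIsogenySelmerRank 10 8 + twoIsogenySelmerRank' 10 8 ≤
      (⟨0, ((10 : ℤ) : ℚ), 0, ((8 : ℤ) : ℚ), 0⟩ : WeierstrassCurve ℚ).mordellWeilRank + 2 := by
    rw [lit_X]
    have h := twoIsogenySelmerRank_X_add_le
    omega
  have h := forall_mem_sha_two_smul_eq_zero_of_selmerRank_add_le (a := 10) (b := 8) habX hle
  rwa [lit_X] at h

/-- **`rank X(ℚ) = 2` and `t_2(X) = 0`** once `rank ≥ 2`. [cite: SilvermanAEC2009, Prop. X.4.7 with Thm. X.4.2(a)]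
[cite: Greenberg1999LNM, §1 pp. 54–57] -/
theorem rank_eq_two_and_shaCorank_X_two (h2 : 2 ≤ (⟨0, 10, 0, 8, 0⟩ : WeierstrassCurve ℚ).mordellWeilRank) :
    (⟨0, 10, 0, 8, 0⟩ : WeierstrassCurve ℚ).mordellWeilRank = 2 ∧ (⟨0, 10, 0, 8, 0⟩ : WeierstrassCurve ℚ).shaCorank 2 = 0 := by
  haveI := isElliptic_X
  haveI : Fact (Nat.Prime 2) := ⟨Nat.prime_two⟩
  exact ⟨le_antisymm mordellWeilRank_X_le_two h2,
    shaCorank_eq_zero_of_forall _ 2 (forall_mem_sha_X_two_smul_eq_zero h2)⟩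

/-- **On Cremona's model `E₁₀₈₈ = [0, 1, 0, −25, 39]`**: if `2 ≤ rank E(ℚ)` (two independent points) then
`rank E(ℚ) = 2`, `t_2(E) = 0` and `#Ш(E/ℚ)[2] = 1` — the door at `2` for `1088j1` by descent.
[cite: SilvermanAEC2009, Prop. X.4.7, Thm. X.4.2(a) and III.3.1(b)] [cite: Cremona1997Algorithms, Table 1 (curve 1088j1)] -/
theorem door_at_two_of_two_le_rank (h2 : 2 ≤ (⟨0, 1, 0, -25, 39⟩ : WeierstrassCurve ℚ).mordellWeilRank) :
    (⟨0, 1, 0, -25, 39⟩ : WeierstrassCurve ℚ).mordellWeilRank = 2 ∧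
      (⟨0, 1, 0, -25, 39⟩ : WeierstrassCurve ℚ).shaCorank 2 = 0 ∧
      Nat.card ((⟨0, 1, 0, -25, 39⟩ : WeierstrassCurve ℚ).sha[((2 : ℕ) : ℤ)]) = 1 := by
  haveI := isElliptic_X
  haveI := isElliptic_E
  haveI : Fact (Nat.Prime 2) := ⟨Nat.prime_two⟩
  have hrk : (⟨0, 10, 0, 8, 0⟩ : WeierstrassCurve ℚ).mordellWeilRank =
      (⟨0, 1, 0, -25, 39⟩ : WeierstrassCurve ℚ).mordellWeilRank := by
    have h := mordellWeilRank_variableChange_holds (⟨0, 1, 0, -25, 39⟩ : WeierstrassCurve ℚ)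
      (⟨1, 3, 0, 0⟩ : VariableChange ℚ)
    rwa [mordellWeilRank_variableChange, smul_E_eq_X] at h
  have h2X : 2 ≤ (⟨0, 10, 0, 8, 0⟩ : WeierstrassCurve ℚ).mordellWeilRank := by rw [hrk]; exact h2
  obtain ⟨hr, ht⟩ := rank_eq_two_and_shaCorank_X_two h2X
  refine ⟨by rw [← hrk]; exact hr, by rw [isIsogenous_E_X.shaCorank_eq 2]; exact ht, ?_⟩
  -- `#Ш(E)[2] = #Ш(X)[2] = 1`
  have hX1 : Nat.card ((⟨0, 10, 0, 8, 0⟩ : WeierstrassCurve ℚ).sha[((2 : ℕ) : ℤ)]) = 1 := by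
    have hbot : (⟨0, 10, 0, 8, 0⟩ : WeierstrassCurve ℚ).sha[((2 : ℕ) : ℤ)] = ⊥ := by
      refine (AddSubgroup.eq_bot_iff_forall _).mpr fun x hx ↦ Subtype.ext ?_
      have hx' : 2 • (x : (⟨0, 10, 0, 8, 0⟩ : WeierstrassCurve ℚ).galH1) = 0 := by
        rw [← AddSubgroupClass.coe_nsmul, AddSubgroup.torsionBy.nsmul_iff.mp hx, ZeroMemClass.coe_zero]
      exact forall_mem_sha_X_two_smul_eq_zero h2X _ x.2 hx'
    rw [hbot]; exact AddSubgroup.card_bot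
  rw [← natCard_sha_torsionBy_variableChange (⟨0, 1, 0, -25, 39⟩ : WeierstrassCurve ℚ)
    (⟨1, 3, 0, 0⟩ : VariableChange ℚ) 2, smul_E_eq_X]
  exact hX1

end Curve1088j1

end Literature.NumberTheory.EllipticCurves

end
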